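import Summits.ValiantsHypothesis.ValiantsHypothesis.Theorems.SymPencilEquivariantSdcNotQPYoungDegreeBound
import HarnessLib

/-!
# ValiantsHypothesis / SymPencil — crux `SymmetrizePermPairs` (stmt-ValiantsHypothesis-17793),
# stub `stub_induce`, small-index regime, piece (K4): TWO-DEGREE YOUNG FIXED VECTORS

Piece (K4) of the tenure's cut for `stub_induce` (`NOTE-p7g11-17793-stub_induce-sizing.md` §CUT):
after the group step ((C1)/(C2): a small-index `H ≤ 𝔖_n × 𝔖_n` contains `Alt(Ω∖X₁) × Alt(Ω∖X₂)`,
two DIFFERENT degrees `a = n − |X₁|`, `b = n − |X₂|` in general) the Young-subgroup fixed-vector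
input (H2) of the closed sister crux `EquivariantSdcNotQP` is needed for `𝔄_a × 𝔄_b` instead of
`𝔄_n × 𝔄_n`.  This file is that generalisation:

* `youngFixedVector_two_of_degreeBound : (YD) → (H2)₂` — the product glue of
  `youngFixedVector_of_degreeBound` run with two degrees (the per-factor input
  `alternating_fixed_vector` is single-group already);
* `youngFixedVector_two_holds` — (H2)₂ unconditionally, from the landed `youngDegreeBound_holds`
  ((YD), `c = 8`): every representation of `𝔄_a × 𝔄_b` on `ℂ^k`, `k ≥ 1`, has a nonzero linear
  functional fixed by a subgroup of index `≤ 2^{(log₂ k + log₂ max(a,b) + 10)^10}`.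

Honest framing: helper layer for an OPEN stub (`stub_induce`) of an OPEN crux (`SymmetrizePermPairs`);
the two-degree spin dichotomy (K3), the assembly and the equivariant-GKKP core (C3) are untouched;
`VP ≠ VNP` is NOT proved and nothing here is progress on it.  No new definitions, no named facts
(`--supports stmt-ValiantsHypothesis-17793 --as helper`).
-/

noncomputable section

-- `Summit.ValiantsHypothesis.ValiantsHypothesis.…` is the tree's mandated single-conjunct layout
-- (Sub = Summit), so the duplicated namespace component is intended.
set_option linter.dupNamespace false

namespace Summit.ValiantsHypothesis.ValiantsHypothesis.Theorems.SymPencilEquivariantSdcNotQP.YoungBounds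

open Literature.NumberTheory.DiophantineGeometry Matrix

/-- **Two-degree (H2) from the Young-tableaux degree inequality (YD).**  For every finite-dimensional
representation `σ` of `𝔄_a × 𝔄_b` on `ℂ^k` (`k ≥ 1`) there are a subgroup `Y ≤ 𝔄_a × 𝔄_b` of index
`≤ 2^{(log₂ k + log₂ max(a,b) + c)^c}` and a nonzero linear functional fixed by `Y` — the glue of
`youngFixedVector_of_degreeBound` (the case `a = b`) run with two degrees: a Young subgroup `Y₁ ≤ 𝔄_a`
fixing a vector of the contragredient first-factor action (`alternating_fixed_vector a`), then
`Y₂ ≤ 𝔄_b` on the `Y₁`-fixed subspace (`alternating_fixed_vector b`), budgets via (YD) for `a` and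
for `b` and `log₂ a, log₂ b ≤ log₂ max(a,b)`. [folklore] -/
theorem youngFixedVector_two_of_degreeBound
    (hYD : ∃ c : ℕ, ∀ (n : ℕ) (lam : Nat.Partition n), ∃ ν : Nat.Partition n,
      (ν = lam ∨ ν = lam.transpose) ∧
        (rowStabilizer ν).index ≤ 2 ^ ((Nat.log 2 (numStandardTableaux lam) + Nat.log 2 n + c) ^ c)) :
    ∃ c : ℕ, ∀ (a b k : ℕ)
      (σ : ↥(alternatingGroup (Fin a)) × ↥(alternatingGroup (Fin b)) →* GL (Fin k) ℂ), 1 ≤ k →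
      ∃ Y : Subgroup (↥(alternatingGroup (Fin a)) × ↥(alternatingGroup (Fin b))),
        Y.index ≤ 2 ^ ((Nat.log 2 k + Nat.log 2 (max a b) + c) ^ c) ∧
        ∃ ℓ : (Fin k → ℂ) →ₗ[ℂ] ℂ, ℓ ≠ 0 ∧
          ∀ y ∈ Y, ℓ ∘ₗ Matrix.toLin' (σ y : Matrix (Fin k) (Fin k) ℂ) = ℓ := by
  classical
  obtain ⟨c, hc⟩ := hYD
  refine ⟨c + 2, fun a b k σ hk => ?_⟩
  set G₁ := ↥(alternatingGroup (Fin a)) with hG₁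
  set G₂ := ↥(alternatingGroup (Fin b)) with hG₂
  -- the contragredient action on `ℂ^k`
  let ρ' : (G₁ × G₂) →* ((Fin k → ℂ) →ₗ[ℂ] (Fin k → ℂ)) :=
    { toFun := fun g => Matrix.toLin' ((σ g⁻¹ : Matrix (Fin k) (Fin k) ℂ)ᵀ)
      map_one' := by
        rw [inv_one, map_one, Units.val_one, Matrix.transpose_one, Matrix.toLin'_one]
        rfl
      map_mul' := fun g h => by
        rw [_root_.mul_inv_rev, map_mul, Units.val_mul, Matrix.transpose_mul, Matrix.toLin'_mul]
        rfl }
  have hρ' : ∀ g, ρ' g = Matrix.toLin' ((σ g⁻¹ : Matrix (Fin k) (Fin k) ℂ)ᵀ) := fun g => rfl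
  -- budgets
  have hbudget : ∀ f n : ℕ, f ≤ 2 * k → n ≤ max a b →
      2 ^ ((Nat.log 2 f + Nat.log 2 n + c) ^ c) ≤
        2 ^ ((Nat.log 2 k + 1 + Nat.log 2 (max a b) + c) ^ c) := by
    intro f n hf hn
    refine Nat.pow_le_pow_right (by norm_num) (Nat.pow_le_pow_left ?_ c)
    have h1 : Nat.log 2 f ≤ Nat.log 2 (2 * k) := Nat.log_mono_right hf
    have h2 : Nat.log 2 (2 * k) = Nat.log 2 k + 1 := by
      rw [mul_comm]; exact Nat.log_mul_base one_lt_two (by omega)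
    have h3 : Nat.log 2 n ≤ Nat.log 2 (max a b) := Nat.log_mono_right hn
    omega
  haveI : Nonempty (Fin k) := ⟨⟨0, hk⟩⟩
  -- first factor
  let ρ₁ : Representation ℂ G₁ (Fin k → ℂ) := ρ'.comp (MonoidHom.inl G₁ G₂)
  have hρ₁ : ∀ x : G₁, ρ₁ x = ρ' (x, 1) := fun x => rfl
  obtain ⟨lam₁, hdim₁, hfix₁⟩ := alternating_fixed_vector a ρ₁
  rw [Module.finrank_fin_fun] at hdim₁
  obtain ⟨ν₁, hν₁, hidx₁⟩ := hc a lam₁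
  obtain ⟨Y₁, hY₁, v, hv0, hv⟩ := hfix₁ ν₁ hν₁
  -- the subspace of `Y₁`-fixed vectors, invariant under the second factor
  let W : Submodule ℂ (Fin k → ℂ) :=
    { carrier := {w | ∀ y ∈ Y₁, ρ₁ y w = w}
      zero_mem' := by intro y _; simp
      add_mem' := by
        intro a b ha hb y hy
        rw [map_add, ha y hy, hb y hy]
      smul_mem' := by
        intro r a ha y hy
        rw [map_smul, ha y hy] }
  have hW : ∀ w, w ∈ W ↔ ∀ y ∈ Y₁, ρ₁ y w = w := fun w => Iff.rfl
  have hcomm : ∀ (x : G₁) (z : G₂) (w : Fin k → ℂ),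
      ρ' (x, 1) (ρ' (1, z) w) = ρ' (1, z) (ρ' (x, 1) w) := by
    intro x z w
    rw [← Module.End.mul_apply, ← map_mul, ← Module.End.mul_apply, ← map_mul]
    have h : ((x, 1) : G₁ × G₂) * (1, z) = (1, z) * (x, 1) := by ext <;> simp
    rw [h]
  have hWinv : ∀ (z : G₂), ∀ w ∈ W, ρ' (1, z) w ∈ W := by
    intro z w hw y hy
    rw [hρ₁, hcomm, ← hρ₁, hw y hy]
  let ρ₂ : Representation ℂ G₂ W :=
    { toFun := fun z => (ρ' (1, z)).restrict (hWinv z)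
      map_one' := by
        apply LinearMap.ext; intro w; apply Subtype.ext
        simp only [LinearMap.coe_restrict_apply, Module.End.one_apply]
        rw [show ((1 : G₁), (1 : G₂)) = (1 : G₁ × G₂) from rfl, map_one, Module.End.one_apply]
      map_mul' := fun x z => by
        apply LinearMap.ext; intro w; apply Subtype.ext
        simp only [LinearMap.coe_restrict_apply, Module.End.mul_apply]
        rw [← Module.End.mul_apply, ← map_mul]
        rfl }
  have hρ₂ : ∀ (z : G₂) (w : W), ((ρ₂ z w : W) : Fin k → ℂ) = ρ' (1, z) (w : Fin k → ℂ) :=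
    fun z w => rfl
  haveI : Nontrivial W := ⟨⟨⟨v, (hW v).2 hv⟩, 0, fun h => hv0 (congrArg Subtype.val h)⟩⟩
  obtain ⟨lam₂, hdim₂, hfix₂⟩ := alternating_fixed_vector b ρ₂
  have hdim₂' : numStandardTableaux lam₂ ≤ 2 * k := by
    have : Module.finrank ℂ W ≤ k := by
      calc Module.finrank ℂ W ≤ Module.finrank ℂ (Fin k → ℂ) := Submodule.finrank_le W
        _ = k := Module.finrank_fin_fun ℂ
    omega
  obtain ⟨ν₂, hν₂, hidx₂⟩ := hc b lam₂
  obtain ⟨Y₂, hY₂, w, hw0, hw⟩ := hfix₂ ν₂ hν₂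
  -- the subgroup and the functional
  refine ⟨Y₁.prod Y₂, ?_, ?_⟩
  · rw [Subgroup.index_prod]
    calc Y₁.index * Y₂.index
        ≤ 2 ^ ((Nat.log 2 k + 1 + Nat.log 2 (max a b) + c) ^ c) *
            2 ^ ((Nat.log 2 k + 1 + Nat.log 2 (max a b) + c) ^ c) :=
          Nat.mul_le_mul (hY₁.trans (hidx₁.trans (hbudget _ _ hdim₁ (le_max_left a b))))
            (hY₂.trans (hidx₂.trans (hbudget _ _ hdim₂' (le_max_right a b))))
      _ ≤ 2 ^ ((Nat.log 2 k + Nat.log 2 (max a b) + (c + 2)) ^ (c + 2)) := sq_budget_le _ _ _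
  · set wv : Fin k → ℂ := (w : Fin k → ℂ) with hwv
    have hwv0 : wv ≠ 0 := fun h => hw0 (Subtype.ext h)
    -- `wv` is fixed by `ρ' y` for every `y ∈ Y₁ × Y₂`
    have hfixed : ∀ y ∈ Y₁.prod Y₂, ρ' y wv = wv := by
      rintro ⟨y₁, y₂⟩ hy
      rw [Subgroup.mem_prod] at hy
      obtain ⟨hy₁, hy₂⟩ := hy
      have h1 : ((y₁, y₂) : G₁ × G₂) = (y₁, 1) * (1, y₂) := by ext <;> simp
      have h2 : ρ' (1, y₂) wv = wv := by
        have := congrArg Subtype.val (hw y₂ hy₂)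
        rwa [hρ₂] at this
      have h3 : ρ' (y₁, 1) wv = wv := by rw [← hρ₁]; exact (hW wv).1 w.2 y₁ hy₁
      rw [h1, map_mul, Module.End.mul_apply, h2, h3]
    -- the functional `x ↦ wv ⬝ᵥ x`
    let ℓ : (Fin k → ℂ) →ₗ[ℂ] ℂ :=
      { toFun := fun x => wv ⬝ᵥ x
        map_add' := fun x y => dotProduct_add wv x y
        map_smul' := fun r x => by rw [dotProduct_smul]; rfl }
    have hℓ : ∀ x, ℓ x = wv ⬝ᵥ x := fun x => rfl
    refine ⟨ℓ, ?_, fun y hy => ?_⟩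
    · intro h
      apply hwv0
      funext i
      have := congrArg (fun f : (Fin k → ℂ) →ₗ[ℂ] ℂ => f (Pi.single i 1)) h
      simp only [hℓ, dotProduct_single, mul_one, LinearMap.zero_apply] at this
      exact this
    · have hyinv : ρ' y⁻¹ wv = wv := hfixed y⁻¹ (inv_mem hy)
      rw [hρ', inv_inv, Matrix.toLin'_apply, Matrix.mulVec_transpose] at hyinv
      apply LinearMap.ext
      intro x
      rw [LinearMap.comp_apply, hℓ, hℓ, Matrix.toLin'_apply, Matrix.dotProduct_mulVec, hyinv]

/-- **(H2) for two degrees, unconditionally**: every representation of `𝔄_a × 𝔄_b` on `ℂ^k`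
(`k ≥ 1`) has a nonzero linear functional fixed by a subgroup of index
`≤ 2^{(log₂ k + log₂ max(a,b) + c)^c}` — from `youngFixedVector_two_of_degreeBound` and the landed
Young-tableaux degree inequality `youngDegreeBound_holds`. [folklore] -/
theorem youngFixedVector_two_holds : ∃ c : ℕ, ∀ (a b k : ℕ)
      (σ : ↥(alternatingGroup (Fin a)) × ↥(alternatingGroup (Fin b)) →* GL (Fin k) ℂ), 1 ≤ k →
      ∃ Y : Subgroup (↥(alternatingGroup (Fin a)) × ↥(alternatingGroup (Fin b))),
        Y.index ≤ 2 ^ ((Nat.log 2 k + Nat.log 2 (max a b) + c) ^ c) ∧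
        ∃ ℓ : (Fin k → ℂ) →ₗ[ℂ] ℂ, ℓ ≠ 0 ∧
          ∀ y ∈ Y, ℓ ∘ₗ Matrix.toLin' (σ y : Matrix (Fin k) (Fin k) ℂ) = ℓ :=
  youngFixedVector_two_of_degreeBound youngDegreeBound_holds

end Summit.ValiantsHypothesis.ValiantsHypothesis.Theorems.SymPencilEquivariantSdcNotQP.YoungBounds

end
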